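import Literature.AnabelianGeometry.SemiGraphs.TemperedCompactPairBridgeOpen
import Literature.AnabelianGeometry.SemiGraphs.TemperedPersistentCompactOfLocallyFinite
import Literature.AnabelianGeometry.SemiGraphs.TemperedMaximalCompactAnchoredOfLocallyFinite
import Literature.AnabelianGeometry.SemiGraphs.TemperedChartTransport
import Literature.AnabelianGeometry.SemiGraphs.TemperedReconstructionCor39IsoFiniteVertices
import Literature.AnabelianGeometry.SemiGraphs.ThetaRayRefutationMaximalCompact
import Literature.AnabelianGeometry.SemiGraphs.ThetaRayRefutation
import HarnessLib

/-!
# [SemiAnbd] Thm 3.7 (iv), SECOND SENTENCE, holds at EVERY countable LOCALLY FINITE graph: exotic maximal compact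
# subgroups of `π₁^temp(𝒢)` are ISOLATED («T37iv-S2@THM37-ALL», locally finite part)

Mochizuki, *Semi-graphs of anabelioids*, Publ. RIMS **42** (2006), §3, Theorem 3.7 (iv), manuscript p. 41: "The
maximal compact subgroups of `π₁^temp(𝒢)` are precisely the verticial subgroups. The nontrivial intersections of two
distinct maximal compact subgroups of `π₁^temp(𝒢)` are precisely the edge-like subgroups."
[cite: MochizukiSemiAnbd2006, Thm 3.7(iv) p.41]; Lemma 1.8 (ii) p. 20.

PROOF-ONLY file (abc-iut cell, layer L3, row «T37iv-S2@THM37-ALL», seat abc-iut-L3-t8 gen 9; no definition, no named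
fact).  For EVERY countable LOCALLY FINITE semi-graph of anabelioids `𝒢` satisfying the hypotheses of Thm 3.7 (any
vertex and edge groups, open edges allowed) — the class containing the ray `𝒢_θ` at which the FIRST sentence of
Thm 3.7 (iv) FAILS in the cell's ∀-countable typing (abc-iut-L3-d4, `thetaRayFreeProP_not_maximalCompactIffVerticialAt`):

* `mem_zpowers_fixes_vertex` — the powers of an element fixing a tree vertex fix it;
* **`certificate_of_forall_not_mem_of_isLocallyFinite`** — an element `d` lying in NO verticial subgroup carries the
  FULL EDGE CERTIFICATE «for every base edge `n`, from some level on `d` fixes no edge of `𝒢_{∞,M}` over `n`»: the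
  ESCAPE DICHOTOMY of the locally finite theory (`le_verticial_or_forall_finite_escape_temperedPiChart`, applied to
  `⟨d⟩` and the finite set of ends of `n`);
* **`le_of_isMaximalCompactSubgroup_of_inf_ne_bot_of_forall_not_le_of_isLocallyFinite`** (canonical chart) and
  **`le_of_isMaximalCompactSubgroup_of_inf_ne_bot_of_isLocallyFinite`** (EVERY chart) — ISOLATION: a maximal compact
  subgroup lying in no verticial subgroup CONTAINS every compact subgroup meeting it non-trivially (anchored package
  `exists_mem_verticialSubgroups_of_isMaximalCompactSubgroup_of_isLocallyFinite` + certificate + this seat's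
  two-level bridge `le_of_isMaximalCompactSubgroup_of_certificate'`); `inf_eq_bot_of_isMaximalCompactSubgroup_of_ne_…`;
* ★ **`maximalCompact_inf_iff_edgeLike_of_isLocallyFinite`** — THM 3.7 (iv), SECOND SENTENCE, at every locally
  finite Thm-3.7 graph, every chart: a non-trivial subgroup is the intersection of two distinct maximal compact
  subgroups iff it is an edge-like subgroup of a closed edge («⇐» and the anchored «⇒»: abc-iut-w6-d062/d064/t6's
  `TemperedMaximalCompactAnchoredOfLocallyFinite`; an exotic member is excluded by ISOLATION);
* `thetaRayFreeProP_thm37iv_sentences` — at `𝒢_θ(p, n)`: sentence 1 ✗ (abc-iut-L3-d4) ∧ sentence 2 ✓.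

Honest framing: statements about OUR typed `π₁^temp` of countable locally finite carriers; print's Thm 3.7 (iv)
concerns the graphs of [SemiAnbd] and is untouched; nothing here bears on [IUTchIII] Cor. 3.12; no side taken;
typed ≠ proved.
-/

noncomputable section

open CategoryTheory Topology Filter

namespace Literature.AnabelianGeometry.SemiGraphs

namespace ProfiniteSemiGraph

universe u

variable {𝒢 : ProfiniteSemiGraph.{u}}

/-! ### Powers of an element fixing a vertex fix it -/

/-- The elements of `⟨d⟩` fix every tree vertex fixed by `d` (the stabiliser of a vertex is a subgroup).
[cite: MochizukiSemiAnbd2006, Lem. 1.8(ii) p.20] -/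
theorem mem_zpowers_fixes_vertex {D : GaloisLevelData 𝒢} {h𝒢 : 𝒢.IsCountable} (j : ℕ) (d : D.temperedPi h𝒢)
    {y : (D.tree j).Vertex} (hy : (D.treeAct h𝒢 j d).hom.vertexMap y = y) :
    ∀ g ∈ Subgroup.zpowers d, (D.treeAct h𝒢 j g).hom.vertexMap y = y := by
  let S : Subgroup (D.temperedPi h𝒢) :=
    { carrier := {g | (D.treeAct h𝒢 j g).hom.vertexMap y = y}
      mul_mem' := by
        intro a b ha hb
        change (D.treeAct h𝒢 j (a * b)).hom.vertexMap y = y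
        rw [map_mul]
        change ((D.treeAct h𝒢 j b).hom ≫ (D.treeAct h𝒢 j a).hom).vertexMap y = y
        rw [SemiGraph.comp_vertexMap, Function.comp_apply]
        rw [show (D.treeAct h𝒢 j b).hom.vertexMap y = y from hb]
        exact ha
      one_mem' := by
        change (D.treeAct h𝒢 j 1).hom.vertexMap y = y
        rw [map_one]
        rfl
      inv_mem' := by
        intro a ha
        change (D.treeAct h𝒢 j a⁻¹).hom.vertexMap y = y
        rw [map_inv]
        change (D.treeAct h𝒢 j a).inv.vertexMap y = y
        have h1 : (D.treeAct h𝒢 j a).inv.vertexMap ((D.treeAct h𝒢 j a).hom.vertexMap y) = y := by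
          rw [← Function.comp_apply (f := (D.treeAct h𝒢 j a).inv.vertexMap), ← SemiGraph.comp_vertexMap,
            (D.treeAct h𝒢 j a).hom_inv_id, SemiGraph.id_vertexMap, id]
        rw [show (D.treeAct h𝒢 j a).hom.vertexMap y = y from ha] at h1
        exact h1 }
  have hd : d ∈ S := hy
  intro g hg
  exact (Subgroup.zpowers_le.mpr hd) hg

/-! ### The edge certificate at a locally finite graph -/

/-- **An element of `π₁^temp(𝒢)` lying in NO verticial subgroup carries the FULL EDGE CERTIFICATE, for `𝒢`
locally finite** (canonical chart): for every base edge `n` there is a level `M₀` such that for all `M ≥ M₀` the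
element fixes no edge of `𝒢_{∞,M}` over `n`.  The escape dichotomy of the locally finite theory, applied to `⟨d⟩`
and the finite set of vertices of `n`, gives a level `k` with no `⟨d⟩`-fixed vertex over an end of `n`; a `d`-fixed
edge over `n` at a level `M ≥ k` has an abutting branch, whose vertex is `d`-fixed and projects to a `⟨d⟩`-fixed
vertex of `𝒢_{∞,k}` over an end of `n`. [cite: MochizukiSemiAnbd2006, Thm 3.7(iii) pp.40-41] -/
theorem certificate_of_forall_not_mem_of_isLocallyFinite (h37 : 𝒢.Thm37Hypotheses) (hlf : 𝒢.graph.IsLocallyFinite)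
    (d : (𝒢.galoisLevelData h37.toProp36Hypotheses).temperedPi h37.toProp36Hypotheses.isCountable)
    (hd : ∀ (v : 𝒢.graph.Vertex) (H : Subgroup (𝒢.temperedPiChart h37.toProp36Hypotheses).G),
      H ∈ verticialSubgroups (𝒢.temperedPiChart h37.toProp36Hypotheses) v → d ∉ H) (n : 𝒢.graph.Edge) :
    ∃ M₀ : ℕ, ∀ M, M₀ ≤ M → ∀ ε : ((𝒢.galoisLevelData h37.toProp36Hypotheses).tree M).Edge,
      ((𝒢.galoisLevelData h37.toProp36Hypotheses).treeProj M).edgeMap ε = n →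
        ((𝒢.galoisLevelData h37.toProp36Hypotheses).treeAct h37.toProp36Hypotheses.isCountable M d).hom.edgeMap ε
          ≠ ε := by
  classical
  have h36 := h37.toProp36Hypotheses
  let Dg := 𝒢.galoisLevelData h36
  have hc := h36.isCountable
  let D₀ : VerticialLevelData.{0} 𝒢 (𝒢.temperedPiChart h36) := verticialLevelData_temperedPiChart (h36 := h36)
  rcases 𝒢.le_verticial_or_forall_finite_escape_temperedPiChart h37 hlf (Subgroup.zpowers d) with
      ⟨v, H, hH, hle⟩ | hesc
  · exact absurd (hle (Subgroup.mem_zpowers d)) (hd v H hH)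
  -- the finite set of ends of `n`
  let S : Set 𝒢.graph.Vertex := {w | ∃ b : 𝒢.graph.Branch, 𝒢.graph.edgeOf b = n ∧ 𝒢.graph.abuts b = some w}
  have hS : S.Finite := by
    obtain ⟨b₁, b₂, -, hb₁, hb₂, hall⟩ := 𝒢.graph.two_branches n
    have hsub : ∀ b : 𝒢.graph.Branch, ({w : 𝒢.graph.Vertex | 𝒢.graph.abuts b = some w}).Subsingleton :=
      fun b w hw w' hw' => Option.some.inj ((hw.symm.trans hw' : some w = some w'))
    refine (((hsub b₁).finite).union ((hsub b₂).finite)).subset ?_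
    rintro w ⟨b, hbn, hbw⟩
    rcases hall b hbn with rfl | rfl
    · exact Or.inl hbw
    · exact Or.inr hbw
  obtain ⟨k, hk⟩ := hesc S hS
  refine ⟨k, fun M hkM ε hεn hεfix => ?_⟩
  -- an abutting branch `β` of `ε`, with vertex `z`, both fixed by `d`
  obtain ⟨β, hβε, hβ⟩ := SemiGraph.exists_abuts_of_isConnected ⟨(Dg.isTree_tree M).isTree.1⟩ (D₀.vertex M) ε
  obtain ⟨z, hz⟩ := Option.isSome_iff_exists.mp hβ
  have hβfix : (Dg.treeAct hc M d).hom.branchMap β = β :=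
    SemiGraph.branchMap_eq_of_over_aut (Dg.treeProj M) (Dg.treeAct hc M d) (Dg.treeAct_over hc M d) β
      (by rw [hβε]; exact hεfix)
  have hzfix : (Dg.treeAct hc M d).hom.vertexMap z = z := SemiGraph.vertexMap_eq_of_branchMap_eq _ hβfix hz
  -- its image `y` at level `k` is fixed by `⟨d⟩` and lies over an end of `n`
  have hyfix : (Dg.treeAct hc k d).hom.vertexMap ((Dg.treeTrans hkM).vertexMap z) = (Dg.treeTrans hkM).vertexMap z := by
    have h : (Dg.treeTrans hkM).vertexMap ((Dg.treeAct hc M d).hom.vertexMap z) =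
        (Dg.treeAct hc k d).hom.vertexMap ((Dg.treeTrans hkM).vertexMap z) := D₀.trans_act_vertexMap hkM d z
    rw [hzfix] at h
    exact h.symm
  have hyS : (D₀.proj k).vertexMap ((Dg.treeTrans hkM).vertexMap z) ∈ S := by
    have h1 : (D₀.proj k).vertexMap ((Dg.treeTrans hkM).vertexMap z) = (Dg.treeProj M).vertexMap z :=
      D₀.proj_vertexMap_trans hkM z
    rw [h1]
    refine ⟨(Dg.treeProj M).branchMap β, ?_, (Dg.treeProj M).abuts_branchMap β z hz⟩
    rw [(Dg.treeProj M).edgeOf_branchMap, hβε, hεn]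
  obtain ⟨g, hg, hgne⟩ := hk _ hyS
  exact hgne (mem_zpowers_fixes_vertex k d hyfix g hg)

/-! ### ISOLATION of the exotic maximal compact subgroups, locally finite graphs -/

/-- **ISOLATION at a locally finite graph (canonical chart).**  A maximal compact subgroup `K₀` of `π₁^temp(𝒢)`
lying in NO verticial subgroup CONTAINS every compact subgroup `K` with `K ⊓ K₀ ≠ 1`: a non-trivial `d ∈ K ⊓ K₀`
lies in no verticial subgroup (else `K₀` would be anchored, hence verticial —
`exists_mem_verticialSubgroups_of_isMaximalCompactSubgroup_of_isLocallyFinite`), so it carries the full edge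
certificate, and the two-level bridge concludes. [cite: MochizukiSemiAnbd2006, Thm 3.7(iv) p.41] -/
theorem le_of_isMaximalCompactSubgroup_of_inf_ne_bot_of_forall_not_le_of_isLocallyFinite (h37 : 𝒢.Thm37Hypotheses)
    (hlf : 𝒢.graph.IsLocallyFinite) (K₀ K : Subgroup (𝒢.temperedPiChart h37.toProp36Hypotheses).G)
    (hK₀ : IsMaximalCompactSubgroup K₀)
    (hK₀no : ∀ (v : 𝒢.graph.Vertex) (H : Subgroup (𝒢.temperedPiChart h37.toProp36Hypotheses).G),
      H ∈ verticialSubgroups (𝒢.temperedPiChart h37.toProp36Hypotheses) v → ¬ K₀ ≤ H)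
    (hK : IsCompact (K : Set (𝒢.temperedPiChart h37.toProp36Hypotheses).G)) (hKK₀ : K ⊓ K₀ ≠ ⊥) : K ≤ K₀ := by
  have h36 := h37.toProp36Hypotheses
  obtain ⟨d, hdmem, hd1⟩ : ∃ d ∈ K ⊓ K₀, d ≠ 1 := by
    by_contra h
    push Not at h
    exact hKK₀ ((Subgroup.eq_bot_iff_forall _).mpr h)
  obtain ⟨hdK, hdK₀⟩ := Subgroup.mem_inf.mp hdmem
  have hdno : ∀ (v : 𝒢.graph.Vertex) (H : Subgroup (𝒢.temperedPiChart h36).G),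
      H ∈ verticialSubgroups (𝒢.temperedPiChart h36) v → d ∉ H := by
    intro v H hH hdH
    have hanch : K₀ ⊓ H ≠ ⊥ := fun hbot =>
      hd1 ((Subgroup.eq_bot_iff_forall _).mp hbot d (Subgroup.mem_inf.mpr ⟨hdK₀, hdH⟩))
    obtain ⟨w, hK₀w⟩ :=
      𝒢.exists_mem_verticialSubgroups_of_isMaximalCompactSubgroup_of_isLocallyFinite h37 hlf _ K₀ hK₀ hH hanch
    exact hK₀no w K₀ hK₀w le_rfl
  -- read everything in the tower's group
  obtain ⟨d₁, rfl⟩ : ∃ d₁ : (𝒢.galoisLevelData h36).temperedPi h36.isCountable, d₁ = d := ⟨d, rfl⟩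
  obtain ⟨K₁, rfl⟩ : ∃ K₁ : Subgroup ((𝒢.galoisLevelData h36).temperedPi h36.isCountable), K₁ = K := ⟨K, rfl⟩
  obtain ⟨K₂, rfl⟩ : ∃ K₂ : Subgroup ((𝒢.galoisLevelData h36).temperedPi h36.isCountable), K₂ = K₀ := ⟨K₀, rfl⟩
  have hK₁c : IsCompact (K₁ : Set ((𝒢.galoisLevelData h36).temperedPi h36.isCountable)) := hK
  have hcert := certificate_of_forall_not_mem_of_isLocallyFinite h37 hlf d₁ hdno
  exact le_of_isMaximalCompactSubgroup_of_certificate' h36 K₁ K₂ hK₁c hK₀ hdK hdK₀ (fun n => hcert n)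

variable (𝒢)

/-- **ISOLATION at EVERY chart of `π₁^temp(𝒢)`, `𝒢` locally finite**: a maximal compact subgroup lying in no
verticial subgroup contains every compact subgroup meeting it non-trivially (transport of the canonical-chart
statement along `TemperedPiChart.exists_compatIso`). [cite: MochizukiSemiAnbd2006, Thm 3.7(iv) p.41] -/
theorem le_of_isMaximalCompactSubgroup_of_inf_ne_bot_of_isLocallyFinite (h37 : 𝒢.Thm37Hypotheses)
    (hlf : 𝒢.graph.IsLocallyFinite) (c : TemperedPiChart 𝒢) (K₀ K : Subgroup c.G)
    (hK₀ : IsMaximalCompactSubgroup K₀)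
    (hK₀no : ∀ (v : 𝒢.graph.Vertex) (H : Subgroup c.G), H ∈ verticialSubgroups c v → ¬ K₀ ≤ H)
    (hK : IsCompact (K : Set c.G)) (hKK₀ : K ⊓ K₀ ≠ ⊥) : K ≤ K₀ := by
  have h36 := h37.toProp36Hypotheses
  obtain ⟨φ, ψ, hψφ, hφψ, hφ, hψ⟩ := TemperedPiChart.exists_compatIso (𝒢.temperedPiChart h36) c
  let e : c.G ≃ₜ* (𝒢.temperedPiChart h36).G :=
    { toFun := ψ, invFun := φ, left_inv := hφψ, right_inv := hψφ, map_mul' := map_mul ψ,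
      continuous_toFun := ψ.continuous, continuous_invFun := φ.continuous }
  have he : e.toMonoidHom = ψ.toMonoidHom := rfl
  have hback : ∀ H : Subgroup c.G, (H.map ψ.toMonoidHom).map φ.toMonoidHom = H := by
    intro H
    ext y
    constructor
    · rintro ⟨_, ⟨z, hz, rfl⟩, rfl⟩
      rw [show φ.toMonoidHom (ψ.toMonoidHom z) = z from hφψ z]; exact hz
    · intro hy
      exact ⟨ψ y, ⟨y, hy, rfl⟩, hφψ y⟩
  have hK₀' : IsMaximalCompactSubgroup (K₀.map ψ.toMonoidHom) := by
    rw [← he]; exact IsMaximalCompactSubgroup.map_equiv e hK₀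
  have hK₀no' : ∀ (v : 𝒢.graph.Vertex) (H : Subgroup (𝒢.temperedPiChart h36).G),
      H ∈ verticialSubgroups (𝒢.temperedPiChart h36) v → ¬ K₀.map ψ.toMonoidHom ≤ H := by
    intro v H hH hle
    refine hK₀no v (H.map φ.toMonoidHom) (mem_verticialSubgroups_map φ hφ hH) ?_
    rw [← hback K₀]
    exact Subgroup.map_mono hle
  have hK' : IsCompact ((K.map ψ.toMonoidHom : Subgroup _) : Set (𝒢.temperedPiChart h36).G) := by
    rw [Subgroup.coe_map]; exact hK.image ψ.continuous
  have hKK₀' : K.map ψ.toMonoidHom ⊓ K₀.map ψ.toMonoidHom ≠ ⊥ := by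
    obtain ⟨d, hdmem, hd1⟩ : ∃ d ∈ K ⊓ K₀, d ≠ 1 := by
      by_contra h
      push Not at h
      exact hKK₀ ((Subgroup.eq_bot_iff_forall _).mpr h)
    obtain ⟨hdK, hdK₀⟩ := Subgroup.mem_inf.mp hdmem
    intro hbot
    have hmem : ψ d ∈ K.map ψ.toMonoidHom ⊓ K₀.map ψ.toMonoidHom := ⟨⟨d, hdK, rfl⟩, ⟨d, hdK₀, rfl⟩⟩
    rw [hbot, Subgroup.mem_bot] at hmem
    apply hd1
    rw [← hφψ d, show ψ d = 1 from hmem, map_one]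
  have hle := le_of_isMaximalCompactSubgroup_of_inf_ne_bot_of_forall_not_le_of_isLocallyFinite h37 hlf _ _ hK₀'
    hK₀no' hK' hKK₀'
  intro x hx
  obtain ⟨y, hy, hyx⟩ := hle ⟨x, hx, rfl⟩
  have : y = x := by rw [← hφψ y, ← hφψ x]; exact congrArg φ hyx
  exact this ▸ hy

/-- **Two DISTINCT maximal compact subgroups, one lying in no verticial subgroup, meet TRIVIALLY** (`𝒢` locally
finite, every chart). [cite: MochizukiSemiAnbd2006, Thm 3.7(iv) p.41] -/
theorem inf_eq_bot_of_isMaximalCompactSubgroup_of_ne_of_isLocallyFinite (h37 : 𝒢.Thm37Hypotheses)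
    (hlf : 𝒢.graph.IsLocallyFinite) (c : TemperedPiChart 𝒢) (K₀ K : Subgroup c.G)
    (hK₀ : IsMaximalCompactSubgroup K₀) (hK : IsMaximalCompactSubgroup K)
    (hK₀no : ∀ (v : 𝒢.graph.Vertex) (H : Subgroup c.G), H ∈ verticialSubgroups c v → ¬ K₀ ≤ H)
    (hne : K ≠ K₀) : K ⊓ K₀ = ⊥ := by
  by_contra h
  exact hne (hK.2 _ hK₀.1
    (𝒢.le_of_isMaximalCompactSubgroup_of_inf_ne_bot_of_isLocallyFinite h37 hlf c K₀ K hK₀ hK₀no hK.1 h)).symm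

/-- **A non-trivial compact subgroup lying in no verticial subgroup lies in AT MOST ONE maximal compact
subgroup** (`𝒢` locally finite, every chart). [cite: MochizukiSemiAnbd2006, Thm 3.7(iv) p.41] -/
theorem maximalCompact_eq_of_le_of_le_of_isLocallyFinite (h37 : 𝒢.Thm37Hypotheses) (hlf : 𝒢.graph.IsLocallyFinite)
    (c : TemperedPiChart 𝒢) (K K₁ K₂ : Subgroup c.G) (hKc : IsCompact (K : Set c.G)) (hKne : K ≠ ⊥)
    (hKno : ∀ (v : 𝒢.graph.Vertex) (H : Subgroup c.G), H ∈ verticialSubgroups c v → ¬ K ≤ H)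
    (hK₁ : IsMaximalCompactSubgroup K₁) (hK₂ : IsMaximalCompactSubgroup K₂) (h₁ : K ≤ K₁) (h₂ : K ≤ K₂) :
    K₁ = K₂ := by
  have hK₁no : ∀ (v : 𝒢.graph.Vertex) (H : Subgroup c.G), H ∈ verticialSubgroups c v → ¬ K₁ ≤ H := by
    intro v H hH hle
    have hbot := 𝒢.inf_verticial_eq_bot_of_forall_not_le_of_isLocallyFinite h37 hlf c K hKc hKno hH
    exact hKne (le_bot_iff.mp (hbot ▸ le_inf le_rfl (h₁.trans hle)))
  by_contra hne
  have hbot := 𝒢.inf_eq_bot_of_isMaximalCompactSubgroup_of_ne_of_isLocallyFinite h37 hlf c K₁ K₂ hK₁ hK₂ hK₁no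
    (Ne.symm hne)
  exact hKne (le_bot_iff.mp (hbot ▸ le_inf h₂ h₁))

/-! ### ★ Thm 3.7 (iv), SECOND SENTENCE, at every locally finite graph, every chart -/

/-- ★ **[SemiAnbd] Thm 3.7 (iv), SECOND SENTENCE, HOLDS at EVERY countable LOCALLY FINITE graph satisfying the
hypotheses of Thm 3.7, at every chart**: a non-trivial subgroup `L ≤ π₁^temp(𝒢)` is the intersection of two
distinct maximal compact subgroups iff it is an edge-like subgroup of a closed edge.  «⇐» and the ANCHORED «⇒» are
abc-iut-w6-d062/d064/t6's `TemperedMaximalCompactAnchoredOfLocallyFinite`; a member of the pair lying in no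
verticial subgroup is excluded by ISOLATION. [cite: MochizukiSemiAnbd2006, Thm 3.7(iv) p.41] -/
theorem maximalCompact_inf_iff_edgeLike_of_isLocallyFinite (h37 : 𝒢.Thm37Hypotheses)
    (hlf : 𝒢.graph.IsLocallyFinite) (c : TemperedPiChart 𝒢) (L : Subgroup c.G) (hL : L ≠ ⊥) :
    (∃ K₁ K₂ : Subgroup c.G, IsMaximalCompactSubgroup K₁ ∧ IsMaximalCompactSubgroup K₂ ∧ K₁ ≠ K₂ ∧ L = K₁ ⊓ K₂) ↔
      ∃ e, 𝒢.graph.IsClosedEdge e ∧ L ∈ edgeLikeSubgroups c e := by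
  constructor
  · rintro ⟨K₁, K₂, hK₁, hK₂, hne, rfl⟩
    have hanch : ∀ {K K' : Subgroup c.G}, IsMaximalCompactSubgroup K → IsMaximalCompactSubgroup K' → K ≠ K' →
        K ⊓ K' ≠ ⊥ → ∃ (v : 𝒢.graph.Vertex) (H : Subgroup c.G), H ∈ verticialSubgroups c v ∧ K ≤ H := by
      intro K K' hK hK' hKK' hbot
      by_contra hno
      push Not at hno
      exact hbot ((inf_comm K K').trans
        (𝒢.inf_eq_bot_of_isMaximalCompactSubgroup_of_ne_of_isLocallyFinite h37 hlf c K K' hK hK'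
          (fun v H hH hle => hno v H hH hle) hKK'.symm))
    obtain ⟨v₁, H₁, hH₁, hK₁H₁⟩ := hanch hK₁ hK₂ hne hL
    exact 𝒢.exists_mem_edgeLikeSubgroups_of_maximalCompact_inf_of_anchored_of_isLocallyFinite h37 hlf c hK₁ hK₂
      hne hL hH₁ (fun h => hL (le_bot_iff.mp (h ▸ le_inf inf_le_left (inf_le_left.trans hK₁H₁))))
  · rintro ⟨e, he, hLe⟩
    exact 𝒢.exists_maximalCompact_inf_eq_of_mem_edgeLikeSubgroups_of_isLocallyFinite h37 hlf c he hLe hL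

variable {𝒢}

/-- **At the ray `𝒢_θ(p, n)` (`n k ≥ k`): THM 3.7 (iv) SENTENCE 1 FAILS (abc-iut-L3-d4,
`thetaRayFreeProP_not_maximalCompactIffVerticialAt`) while SENTENCE 2 HOLDS** (the ray is locally finite and
satisfies the hypotheses of Thm 3.7, `thetaRayFreeProP_thm37Hypotheses'`) — its exotic maximal compact subgroups
are isolated. [cite: MochizukiSemiAnbd2006, Thm 3.7(iv) p.41] -/
theorem thetaRayFreeProP_thm37iv_sentences (p : ℕ) [Fact p.Prime] (n : ℕ → ℕ) (hn : ∀ k, k ≤ n k) :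
    ¬ MaximalCompactIffVerticialAt (thetaRayFreeProP p n) ∧
      ∀ (c : TemperedPiChart (thetaRayFreeProP p n)) (L : Subgroup c.G), L ≠ ⊥ →
        ((∃ K₁ K₂ : Subgroup c.G, IsMaximalCompactSubgroup K₁ ∧ IsMaximalCompactSubgroup K₂ ∧ K₁ ≠ K₂ ∧
            L = K₁ ⊓ K₂) ↔ ∃ e, (thetaRayFreeProP p n).graph.IsClosedEdge e ∧ L ∈ edgeLikeSubgroups c e) :=
  ⟨thetaRayFreeProP_not_maximalCompactIffVerticialAt p n hn,
    (thetaRayFreeProP p n).maximalCompact_inf_iff_edgeLike_of_isLocallyFinite (thetaRayFreeProP_thm37Hypotheses' p n)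
      SemiGraph.ray_isLocallyFinite⟩

end ProfiniteSemiGraph

end Literature.AnabelianGeometry.SemiGraphs

end
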